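import Mathlib
import Summits.QuantumAdvantage.QuantumAdvantage.Theses.LinnikCubicClassGroups
import Literature.Computability.Complexity.Randomized
import Literature.NumberTheory.LFunctions.DedekindZeta
import Literature.NumberTheory.LFunctions.EffectivePrimeIdealTheoremGRH

/-!
# Ideator sketch (round 1, ideator 3) for crux `PureCubicClassNumberHard` (stmt-QuantumAdvantage-11826)

First lemmas / transfer targets of three crux-idea cards, stated over existing declarations only.
Nothing here is proved; every `def … : Prop` must merely elaborate.

* Card `euler-squeeze`      : `eulerTrunc`, `EulerSqueezeERH`, `EulerLimit`, `CoarseRegulatorHard`,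
                              `coarseRegulator_of_classNumber` (the reduction, stated).
* Card `honda-leak`         : `HondaSplitVsInert`, `EisensteinTypeHard`, `eisensteinType_of_classNumber`
                              (+ variants `HondaTwoInertPrimes`, `EisensteinSplitHard`).
* Card `binomial-collapse`  : `BinomialUnitFundamental`, `ResidueValueHardOnBinomialFamily`.
-/

noncomputable section

namespace Summit.QuantumAdvantage.QuantumAdvantage.Cruxes.PureCubicClassNumberHard.IdeatorR1I3

open Literature.Computability.Complexity NumberField

/-! ### Card euler-squeeze -/

/-- Number of prime ideals of `𝓞 K` of absolute norm `p ^ f`. -/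
def localCount (K : Type) [Field K] [NumberField K] (p f : ℕ) : ℕ :=
  Set.ncard {P : Ideal (𝓞 K) | P.IsPrime ∧ Ideal.absNorm P = p ^ f}

/-- The truncated Euler product `E_K(X) = ∏_{p ≤ X} (1 - 1/p) ∏_{𝔭 ∣ p} (1 - N𝔭⁻¹)⁻¹` of `ζ_K/ζ` at
`s = 1` for a field of degree `≤ 3` (residue degrees `f ∈ {1,2,3}`); Cohen GTM 138 Alg. 6.5.6 step 4. -/
def eulerTrunc (K : Type) [Field K] [NumberField K] (X : ℕ) : ℝ :=
  ∏ p ∈ (Finset.range (X + 1)).filter Nat.Prime,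
    ((1 - (p : ℝ)⁻¹) * ∏ f ∈ Finset.Icc 1 3, ((1 - ((p : ℝ) ^ f)⁻¹)⁻¹) ^ localCount K p f)

/-- (A1) Landau–Mertens limit: `E_K(X) → κ_K = 2^{r₁}(2π)^{r₂} h R / (w √|d_K|)` (Mathlib's
`dedekindZeta_residue`) as `X → ∞`, for cubic fields. Unconditional. -/
def EulerLimit : Prop :=
  ∀ (K : Type) [Field K] [NumberField K], Module.finrank ℚ K = 3 →
    Filter.Tendsto (fun X : ℕ => eulerTrunc K X) Filter.atTop (nhds (dedekindZeta_residue K))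

/-- (A2) The squeeze under ERH (Bach 1995 / Belabas–Friedman 2015 shape; to be derived from the
tree's PROVED `effectivePrimeIdealTheorem_of_ERH_holds` by partial summation): under the tree's
universal `ExtendedRiemannHypothesis` (all number fields, hence RH for `ζ` too, needed for the rational
factor), one absolute `c` such that for every cubic `K` and every `X ≥ 2`,
`|log E_K(X) − log κ_K| ≤ c (log|d_K| + log X)² / √X`. -/
def EulerSqueezeERH : Prop :=
  Literature.NumberTheory.LFunctions.ExtendedRiemannHypothesis →
  ∃ c : ℝ, 0 < c ∧ ∀ (K : Type) [Field K] [NumberField K], Module.finrank ℚ K = 3 → ∀ X : ℕ, 2 ≤ X →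
      |Real.log (eulerTrunc K X) - Real.log (dedekindZeta_residue K)| ≤
        c * (Real.log |(NumberField.discr K : ℝ)| + Real.log X) ^ 2 / Real.sqrt X

/-- Transfer target C⁺ (second conjunct): COARSE REGULATOR HARDNESS for prime radicands — no PPT
algorithm outputs, for every prime `p` and every cubic `K ∋ ∛p`, an integer `n` with
`R_K ≤ n ≤ 4 R_K` with probability `≥ 2/3` (`R_K` = Mathlib `NumberField.Units.regulator`). -/
def CoarseRegulatorHard : Prop :=
  ¬ ∃ B : RandAlg (List Bool) (List Bool), B.IsPolyTime id id ∧
    ∀ p : ℕ, p.Prime → ∀ (K : Type) [Field K] [NumberField K], Module.finrank ℚ K = 3 →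
      (∃ α : K, α ^ 3 = (p : K)) →
        (2 : ℝ) / 3 ≤ B.pr id (Computability.encodeNat p)
          {y | Units.regulator K ≤ (Computability.decodeNat y : ℝ) ∧
               (Computability.decodeNat y : ℝ) ≤ 4 * Units.regulator K}

/-- (A3) THE REDUCTION (load-bearing provable stub of the line, modulo A1/A2 and RandAlg plumbing):
under ERH for cubic fields, a PPT algorithm for the class-number bits (the negation of the crux)
yields a PPT coarse-regulator algorithm. With `CoarseRegulatorHard` this closes the crux:
`X_of : EulerLimit → EulerSqueezeERH → (∀ K cubic, ERH K) → CoarseRegulatorHard → PureCubicClassNumberHard`. -/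
def coarseRegulator_of_classNumber : Prop :=
  EulerLimit → EulerSqueezeERH → Literature.NumberTheory.LFunctions.ExtendedRiemannHypothesis →
  (∃ A : RandAlg (List Bool) (List Bool), A.IsPolyTime id id ∧
    ∀ (x : List Bool) (K : Type) [Field K] [NumberField K], Module.finrank ℚ K = 3 →
      (∀ r : ℕ, r ^ 3 ≠ Computability.decodeNat x) → (∃ α : K, α ^ 3 = (Computability.decodeNat x : K)) →
        (2 : ℝ) / 3 ≤ A.pr id x {List.ofFn (fun i : Fin (2 * x.length + 8) => (classNumber K).testBit i.val)}) →
  ∃ B : RandAlg (List Bool) (List Bool), B.IsPolyTime id id ∧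
    ∀ p : ℕ, p.Prime → ∀ (K : Type) [Field K] [NumberField K], Module.finrank ℚ K = 3 →
      (∃ α : K, α ^ 3 = (p : K)) →
        (2 : ℝ) / 3 ≤ B.pr id (Computability.encodeNat p)
          {y | Units.regulator K ≤ (Computability.decodeNat y : ℝ) ∧
               (Computability.decodeNat y : ℝ) ≤ 4 * Units.regulator K}

/-- Sanity: the composition really concludes the crux by name (pure logic, proved). -/
theorem crux_of_euler_squeeze (h : coarseRegulator_of_classNumber) (h1 : EulerLimit) (h2 : EulerSqueezeERH)
    (hERH : Literature.NumberTheory.LFunctions.ExtendedRiemannHypothesis)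
    (hR : CoarseRegulatorHard) :
    Summit.QuantumAdvantage.QuantumAdvantage.Theses.LinnikCubicClassGroups.PureCubicClassNumberHard :=
  fun hA => hR (h h1 h2 hERH hA)

/-! ### Card honda-leak -/

/-- (C1) PRIMARY, Hasse-free form — Chevalley genus theory for `N = K(ω)/ℚ(ω)`, split type vs inert
type (load-bearing provable stub): for distinct primes `p, q` with `pq ≡ 1 (mod 9)` and EITHER
`p ≡ q ≡ 1 (mod 3)` OR `{p, q} ≡ {2, 5} (mod 9)`, one has `3 ∣ h(ℚ(∛(pq)))` iff `p ≡ 1 (mod 3)`.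
(Split type: `t = 4` ramified primes of `ℚ(ω)`, `|Cl(N)^σ| ≥ 3^{t-1}/3 = 9`; inert type `{2,5}`:
`t = 2` and `ω` is not even a local norm at `p`, so `|Cl(N)^σ| = 1`.) Kit: j012881 + j013350. -/
def HondaSplitVsInert : Prop :=
  ∀ p q : ℕ, p.Prime → q.Prime → p ≠ q → (p * q) % 9 = 1 →
    ((p % 3 = 1 ∧ q % 3 = 1) ∨ (p % 9 = 2 ∧ q % 9 = 5) ∨ (p % 9 = 5 ∧ q % 9 = 2)) →
    ∀ (K : Type) [Field K] [NumberField K], Module.finrank ℚ K = 3 →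
      (∃ α : K, α ^ 3 = ((p * q : ℕ) : K)) →
        (3 ∣ classNumber K ↔ p % 3 = 1)

/-- (C1') VARIANT, within the inert primes (needs Hasse's norm theorem for the cyclic cubic `N/ℚ(ω)`
in the direction `(8,8) ⇒ 3 ∣ h`) — Honda 1971: for distinct primes `p ≡ q ≡ 2 (mod 3)` with
`pq ≡ 1 (mod 9)` (so `{p,q} mod 9 ∈ {{2,5},{8,8}}`), `3 ∣ h(ℚ(∛(pq)))` iff `p ≡ q ≡ 8 (mod 9)`.
Kit-checked: j012881, 305 pairs (82 certified), 0 mismatches. -/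
def HondaTwoInertPrimes : Prop :=
  ∀ p q : ℕ, p.Prime → q.Prime → p ≠ q → p % 3 = 2 → q % 3 = 2 → (p * q) % 9 = 1 →
    ∀ (K : Type) [Field K] [NumberField K], Module.finrank ℚ K = 3 →
      (∃ α : K, α ^ 3 = ((p * q : ℕ) : K)) →
        (3 ∣ classNumber K ↔ (p % 9 = 8 ∧ q % 9 = 8))

/-- Transfer target C⁺ (primary): HIDDEN EISENSTEIN TYPE is hard — no PPT algorithm decides, given
`N = pq ≡ 1 (mod 9)` under the promise "both `p, q ≡ 1 (mod 3)` or `{p,q} ≡ {2,5} (mod 9)`",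
whether `p ≡ 1 (mod 3)`; equivalently whether `−3` is a square modulo the hidden prime factors of
`N` (Jacobi symbol `(−3/N) = +1` in both cases), the `−3`-analogue of Blum-integer recognition. -/
def EisensteinTypeHard : Prop :=
  ¬ ∃ D : RandAlg (List Bool) Bool, D.IsPolyTime id Computability.encodeBool ∧
    ∀ p q : ℕ, p.Prime → q.Prime → p ≠ q → (p * q) % 9 = 1 →
      ((p % 3 = 1 ∧ q % 3 = 1) ∨ (p % 9 = 2 ∧ q % 9 = 5) ∨ (p % 9 = 5 ∧ q % 9 = 2)) →
      (2 : ℝ) / 3 ≤ D.pr id (Computability.encodeNat (p * q)) {b | b = decide (p % 3 = 1)}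

/-- Transfer target C⁺ (variant): EISENSTEIN-SPLIT HARDNESS (cubic residuosity of the fixed unit `ω`
over `ℤ[ω]` modulo `N = pq`): no PPT algorithm decides, for all distinct primes `p ≡ q ≡ 2 (mod 3)`
with `pq ≡ 1 (mod 9)`, whether `p ≡ q ≡ −1 (mod 9)` (i.e. whether `ω` is a cube in `(ℤ[ω]/N)ˣ`). -/
def EisensteinSplitHard : Prop :=
  ¬ ∃ D : RandAlg (List Bool) Bool, D.IsPolyTime id Computability.encodeBool ∧
    ∀ p q : ℕ, p.Prime → q.Prime → p ≠ q → p % 3 = 2 → q % 3 = 2 → (p * q) % 9 = 1 →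
      (2 : ℝ) / 3 ≤ D.pr id (Computability.encodeNat (p * q)) {b | b = decide (p % 9 = 8 ∧ q % 9 = 8)}

/-- (C2) THE REDUCTION (provable from C1 + RandAlg post-composition with the poly-time map
"bits ↦ [3 ∣ value]"): a PPT class-number algorithm decides the hidden Eisenstein type. Then
`X_of : HondaSplitVsInert → EisensteinTypeHard → PureCubicClassNumberHard`. -/
def eisensteinType_of_classNumber : Prop :=
  HondaSplitVsInert →
  (∃ A : RandAlg (List Bool) (List Bool), A.IsPolyTime id id ∧
    ∀ (x : List Bool) (K : Type) [Field K] [NumberField K], Module.finrank ℚ K = 3 →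
      (∀ r : ℕ, r ^ 3 ≠ Computability.decodeNat x) → (∃ α : K, α ^ 3 = (Computability.decodeNat x : K)) →
        (2 : ℝ) / 3 ≤ A.pr id x {List.ofFn (fun i : Fin (2 * x.length + 8) => (classNumber K).testBit i.val)}) →
  ∃ D : RandAlg (List Bool) Bool, D.IsPolyTime id Computability.encodeBool ∧
    ∀ p q : ℕ, p.Prime → q.Prime → p ≠ q → (p * q) % 9 = 1 →
      ((p % 3 = 1 ∧ q % 3 = 1) ∨ (p % 9 = 2 ∧ q % 9 = 5) ∨ (p % 9 = 5 ∧ q % 9 = 2)) →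
      (2 : ℝ) / 3 ≤ D.pr id (Computability.encodeNat (p * q)) {b | b = decide (p % 3 = 1)}

theorem crux_of_honda_leak (h : eisensteinType_of_classNumber) (h1 : HondaSplitVsInert)
    (hE : EisensteinTypeHard) :
    Summit.QuantumAdvantage.QuantumAdvantage.Theses.LinnikCubicClassGroups.PureCubicClassNumberHard :=
  fun hA => hE (h h1 hA)

/-! ### Card binomial-collapse -/

/-- (B1) Nagell–Stender binomial units (load-bearing provable stub): for `a ≥ 2`, `b ∈ {3, −3}`,
`3 ∤ a` and `m = a³ + b` squarefree, in `K = ℚ(θ)`, `θ³ = m`, the element `η` with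
`b · η = (a − θ)³` is a unit of `𝓞 K` and generates the units up to sign (kit j012881: index 1 for
all 75 tested fields). -/
def BinomialUnitFundamental : Prop :=
  ∀ (a : ℕ) (b : ℤ), 2 ≤ a → (b = 3 ∨ b = -3) → ¬ 3 ∣ a → Squarefree ((a : ℤ) ^ 3 + b) →
    ∀ (K : Type) [Field K] [NumberField K], Module.finrank ℚ K = 3 →
      ∀ θ : 𝓞 K, (θ : K) ^ 3 = (((a : ℤ) ^ 3 + b : ℤ) : K) →
        ∃ η : (𝓞 K)ˣ, (b : 𝓞 K) * (η : 𝓞 K) = ((a : 𝓞 K) - θ) ^ 3 ∧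
          ∀ u : (𝓞 K)ˣ, ∃ n : ℤ, u = η ^ n ∨ u = -η ^ n

/-- Transfer target C⁺ of the third card: on the binomial family the regulator is explicit, so the
crux restricted there is literally n-bit hardness of the residue `κ_K = Res_{s=1} ζ_K = L(1, ψ_m)`
(relative precision `2^{-2|x|}`): no PPT outputs such an approximation for all squarefree
`m = a³ ± 3`, `3 ∤ a`. -/
def ResidueValueHardOnBinomialFamily : Prop :=
  ¬ ∃ B : RandAlg (List Bool) (List Bool), B.IsPolyTime id id ∧
    ∀ (a : ℕ) (b : ℤ), 2 ≤ a → (b = 3 ∨ b = -3) → ¬ 3 ∣ a → Squarefree ((a : ℤ) ^ 3 + b) →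
      ∀ (K : Type) [Field K] [NumberField K], Module.finrank ℚ K = 3 →
        (∃ θ : K, θ ^ 3 = (((a : ℤ) ^ 3 + b : ℤ) : K)) →
          (2 : ℝ) / 3 ≤ B.pr id (Computability.encodeNat ((a : ℤ) ^ 3 + b).toNat)
            {y | |(Computability.decodeNat y : ℝ) * (2 : ℝ) ^ (-(4 * (Nat.size ((a : ℤ) ^ 3 + b).toNat) : ℤ))
                    - dedekindZeta_residue K|
                 ≤ (2 : ℝ) ^ (-(2 * (Nat.size ((a : ℤ) ^ 3 + b).toNat) : ℤ)) * dedekindZeta_residue K}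

end Summit.QuantumAdvantage.QuantumAdvantage.Cruxes.PureCubicClassNumberHard.IdeatorR1I3
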